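import Summits.CriticalPhenomena.CardyFormulaZ2.Theorems.CardyComplexConeEdgePrecompactUFRSSimpleLoopWinding

/-!
# Hopf's Umlaufsatz with the sign of the winding number for simple rectilinear lattice loops
(line `qkz-strip-boundary-arm` of crux `CardyComplexCone.EdgePrecompact`, stmt-CriticalPhenomena-11387;
second file of the proof of the OPEN-ARC HOPF FORMULA for the oriented medial graph, after
`…UFRSSimpleLoopWinding.lean`)

* `simpleLoop_cycTurn_eq_ST` (registered): for a rectilinear lattice loop `l` (`RectLoop.IsLoop`) and any of
  its steps `d ∈ cdarts l`, `RectLoop.cycTurn l = 4 + 8 · wnd l (rf d)`: the loop turns by `+4` quarter turns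
  and the face to the right of every step has winding number `0` (counter-clockwise, interior on the left), or
  by `-4` and that winding number is `-1` (clockwise, interior on the right). This is the rectilinear
  Umlaufsatz `RectLoop.IsLoop.cycTurn_eq` of the tree together with the part of the Jordan curve theorem for
  lattice polygons that the open-arc formula consumes.
* `simpleLoop_wnd_sides_ST`: equivalently `cycTurn l = 4 · (wnd l (lf d) + wnd l (rf d))`.

Proof: the induction of `RectilinearUmlaufsatz.lean` verbatim (strong induction on the length, then on the
potential `height B`; walk along the diagonal of corners of type `{e₀, -e₁}` from the top-left vertex;
`cornerAt_topleft`, `cornerAt_next`, pigeonhole), with the property "`cycTurn l = 4 + 8 · wnd l (rf d)` for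
some step `d`" in place of "`cycTurn l = ±4`": the three moves preserve the turning (`cycTurn_flip/fwd/bwd`)
and the right winding number (`wnd_rf_flip/fwd/bwd_ST`), which is constant along a loop
(`simpleLoop_wnd_rf_eq_ST`); base case: a loop with four vertices seen from its top-left vertex is the unit
square below-right of it, run clockwise (`-4`, right face inside, winding `-1`) or counter-clockwise (`+4`,
right face outside, winding `0`).

References: H. Hopf, Compositio Math. 2 (1935), Satz I; folklore (orthogonal polygons).
-/

namespace Summit.CriticalPhenomena.CardyFormulaZ2.Cruxes.EdgePrecompact.QkzStripBoundaryArm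

open Literature.Probability.LatticeModels Literature.Probability.LatticeModels.MedialTrail
open Literature.Topology.PlaneTopology Literature.Topology.PlaneTopology.RectLoop
open List

-- The property proved by induction: `∃ d ∈ cdarts l, cycTurn l = 4 + 8 * wnd l (rf d)` — the turning is
-- `4 + 8 R`, `R` the right winding number at some step.

/-- The property is invariant under rotation of the loop. -/
theorem QQ_of_isRotated_ST {l l' : List (ℤ × ℤ)} (h : l ~r l') (h3 : 3 ≤ l.length) (hQ : (∃ d ∈ cdarts l, cycTurn l = 4 + 8 * wnd l (rf d))) : (∃ d ∈ cdarts l', cycTurn l' = 4 + 8 * wnd l' (rf d)) := by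
  obtain ⟨d, hd, e⟩ := hQ
  obtain ⟨n, rfl⟩ := h
  refine ⟨d, ?_, ?_⟩
  · rw [cdarts_rotate]; exact List.mem_rotate.2 hd
  · rw [cycTurn_rotate h3, wnd_rotate, e]

/-- From one step to every step. -/
theorem QQ_all_ST {l : List (ℤ × ℤ)} (hl : IsLoop l) (hQ : (∃ d ∈ cdarts l, cycTurn l = 4 + 8 * wnd l (rf d))) {d : Pt × Pt} (hd : d ∈ cdarts l) :
    cycTurn l = 4 + 8 * wnd l (rf d) := by
  obtain ⟨d', hd', e⟩ := hQ
  rw [e, simpleLoop_wnd_rf_eq_ST hl hd' hd]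

/-! ## Base case: four vertices -/

/-- The winding number of a loop with four vertices is the sum of four contributions. -/
theorem wnd_four_ST (P₀ P₁ P₂ P₃ F : Pt) :
    wnd [P₀, P₁, P₂, P₃] F = dartWnd (P₀, P₁) F + dartWnd (P₁, P₂) F + dartWnd (P₂, P₃) F + dartWnd (P₃, P₀) F := by
  rw [wnd, cdarts_four]; simp [dwnd]; ring

/-- **Base case.** A loop with four vertices whose first vertex is top-left is the unit square below-right of
it: clockwise with turning `-4` and right winding number `-1`, or counter-clockwise with `+4` and `0`. -/
theorem base_four_ST {q x₁ x₂ x₃ : ℤ × ℤ} (h : IsLoop [q, x₁, x₂, x₃])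
    (htop : ∀ p ∈ [q, x₁, x₂, x₃], p.2 < q.2 ∨ (p.2 = q.2 ∧ q.1 ≤ p.1)) :
    cycTurn [q, x₁, x₂, x₃] = 4 + 8 * wnd [q, x₁, x₂, x₃] (rf (q, x₁)) := by
  have hc := h.chain
  have hnd := h.nodup
  simp only [cons_append, take_succ_cons, take_zero, nil_append, isChain_cons_cons] at hc
  simp only [nodup_cons, mem_cons, not_or, mem_nil_iff, or_false, not_false_eq_true, and_true, nodup_nil] at hnd
  obtain ⟨⟨i, hi⟩, ⟨j, hj⟩, ⟨k, hk⟩, ⟨m, hm⟩, -⟩ := hc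
  have hx3 : x₃ = q + dir (m + 2) := by rw [← neg_dir, hm]; abel
  have hi' := dir_eq_of_topleft htop (c := i) (by rw [← hi]; simp)
  have hm' := dir_eq_of_topleft htop (c := m + 2) (by rw [← hx3]; simp)
  obtain ⟨a, b⟩ := q
  -- `dir j + dir k = x₃ - x₁`
  have hjk : dir j + dir k = x₃ - x₁ := by rw [hk, hj]; abel
  rcases hi' with hi' | hi' <;> rcases hm' with hm' | hm' <;> rw [hi'] at hi <;> rw [hm'] at hx3
  · exact absurd (hi.trans hx3.symm) hnd.2.1.2
  · -- clockwise: `x₁ = q + e₀`, `x₃ = q - e₁`, `x₂ = q + e₀ - e₁`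
    rw [hx3, hi] at hjk
    have hx2 : x₂ = (a + 1, b - 1) := by
      revert hjk; fin_cases j <;> fin_cases k <;> intro hjk <;> simp [dir, Prod.ext_iff] at hjk <;>
        first
        | (exfalso; apply hnd.1.2.1; rw [hj, hi]; ext <;> simp [dir]; done)
        | (rw [hj, hi]; ext <;> simp [dir]; ring)
    subst hi; subst hx3; subst hx2
    have e1 : ((a, b) : ℤ × ℤ) + dir 0 = (a + 1, b) := by ext <;> simp [dir]
    have e3 : ((a, b) : ℤ × ℤ) + dir 3 = (a, b - 1) := by ext <;> simp [dir]; ring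
    rw [e1, e3]
    rw [wnd_four_ST, dartWnd_horiz_ST, dartWnd_south_ST, show ((a + 1, b - 1), (a, b - 1)) = ((a + 1, b - 1), (a, b - 1)) from rfl,
      rf_east, dartWnd_horiz_ST, dartWnd_north'_ST]
    simp [cycTurn, turnSum, cross]
  · -- counter-clockwise: `x₁ = q - e₁`, `x₃ = q + e₀`, `x₂ = q + e₀ - e₁`
    rw [hx3, hi] at hjk
    have hx2 : x₂ = (a + 1, b - 1) := by
      revert hjk; fin_cases j <;> fin_cases k <;> intro hjk <;> simp [dir, Prod.ext_iff] at hjk <;>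
        first
        | (exfalso; apply hnd.1.2.1; rw [hj, hi]; ext <;> simp [dir]; done)
        | (rw [hj, hi]; ext <;> simp [dir]; ring)
    subst hi; subst hx3; subst hx2
    have e0 : ((a, b) : ℤ × ℤ) + dir 0 = (a + 1, b) := by ext <;> simp [dir]
    have e3 : ((a, b) : ℤ × ℤ) + dir 3 = (a, b - 1) := by ext <;> simp [dir]; ring
    rw [e0, e3]
    rw [wnd_four_ST, dartWnd_south_ST, dartWnd_horiz_ST, dartWnd_north'_ST,
      show ((a + 1, b), (a, b)) = ((a + 1, b), (a + 1 - 1, b)) by simp, dartWnd_horiz_ST, rf_south]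
    simp [cycTurn, turnSum, cross]
  · exact absurd (hi.trans hx3.symm) hnd.2.1.2

/-! ## One step of the walk -/

/-- **One step of the walk** (the `QQ`-version of `RectLoop.exists_move_or_cornerAt`). At a corner `v` of type
`{e₀, -e₁}` of a loop `l` with at least five vertices, all at height `≥ B`: either there is a loop `l'` with
`(∃ d ∈ cdarts l', cycTurn l' = 4 + 8 * wnd l' (rf d)) → (∃ d ∈ cdarts l, cycTurn l = 4 + 8 * wnd l (rf d))`, all vertices at height `≥ B`, and smaller measure, or the opposite cell corner is again a
corner of type `{e₀, -e₁}`. -/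
theorem exists_move_or_cornerAt_QQ_ST {l : List (ℤ × ℤ)} (hl : IsLoop l) {v : ℤ × ℤ} (hv : CornerAt l v)
    (B : ℤ) (hB : ∀ p ∈ l, B ≤ p.2) :
    (∃ l', IsLoop l' ∧ ((∃ d ∈ cdarts l', cycTurn l' = 4 + 8 * wnd l' (rf d)) → (∃ d ∈ cdarts l, cycTurn l = 4 + 8 * wnd l (rf d))) ∧
        (l'.length + 2 = l.length ∨ (l'.length = l.length ∧ height B l' < height B l)) ∧
        ∀ p ∈ l', B ≤ p.2) ∨
      CornerAt l (v + dir 0 + dir 3) := by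
  obtain ⟨x₀, x₁, x₃, x₄, R, hrot, h13⟩ := hv
  have hL : IsLoop (x₀ :: x₁ :: v :: x₃ :: x₄ :: R) := by
    obtain ⟨n, hn⟩ := hrot; exact hn ▸ hl.rotate n
  have h3 : 3 ≤ (x₀ :: x₁ :: v :: x₃ :: x₄ :: R).length := by simp
  have hcyc : cycTurn (x₀ :: x₁ :: v :: x₃ :: x₄ :: R) = cycTurn l := cycTurn_eq_of_isRotated hrot hl.three_le
  have hmemL : ∀ p, p ∈ x₀ :: x₁ :: v :: x₃ :: x₄ :: R ↔ p ∈ l := fun p => (hrot.mem_iff).symm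
  have hlenL : (x₀ :: x₁ :: v :: x₃ :: x₄ :: R).length = l.length := hrot.perm.length_eq.symm
  have hhtL : height B (x₀ :: x₁ :: v :: x₃ :: x₄ :: R) = height B l := height_eq_of_perm hrot.perm.symm
  have hBL : ∀ p ∈ x₀ :: x₁ :: v :: x₃ :: x₄ :: R, B ≤ p.2 := fun p hp => hB p ((hmemL p).1 hp)
  have toL : (∃ d ∈ cdarts (x₀ :: x₁ :: v :: x₃ :: x₄ :: R), cycTurn (x₀ :: x₁ :: v :: x₃ :: x₄ :: R) = 4 + 8 * wnd (x₀ :: x₁ :: v :: x₃ :: x₄ :: R) (rf d)) → (∃ d ∈ cdarts l, cycTurn l = 4 + 8 * wnd l (rf d)) := fun hQ => QQ_of_isRotated_ST hrot.symm h3 hQ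
  have hv' : x₁ + x₃ - v = v + dir 0 + dir 3 := by
    rcases h13 with ⟨e1, e3⟩ | ⟨e1, e3⟩ <;> rw [e1, e3] <;> abel
  have hab : cross (x₁ - v) (x₃ - v) ≠ 0 := by
    rcases h13 with ⟨e1, e3⟩ | ⟨e1, e3⟩ <;> rw [e1, e3] <;> simp [cross, dir]
  have hdown : B + 1 ≤ v.2 := by
    have : v + dir 3 ∈ x₀ :: x₁ :: v :: x₃ :: x₄ :: R := by
      rcases h13 with ⟨-, e3⟩ | ⟨e1, -⟩
      · rw [← e3]; simp
      · rw [← e1]; simp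
    have := hBL _ this
    simp [dir] at this
    omega
  by_cases hmem : v + dir 0 + dir 3 ∈ x₀ :: x₁ :: v :: x₃ :: x₄ :: R
  · by_cases h0 : v + dir 0 + dir 3 = x₀
    · -- backward shortcut, in the window `z :: x₀ :: x₁ :: v :: x₃ :: A`
      left
      obtain ⟨A, z, hA⟩ := exists_eq_append_singleton x₄ R
      have hrot2 : (x₀ :: x₁ :: v :: x₃ :: x₄ :: R) ~r (z :: x₀ :: x₁ :: v :: x₃ :: A) := by
        refine ⟨(x₀ :: x₁ :: v :: x₃ :: A).length, ?_⟩
        rw [show x₀ :: x₁ :: v :: x₃ :: x₄ :: R = (x₀ :: x₁ :: v :: x₃ :: A) ++ [z] by simp [hA],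
          rotate_append_length_eq]
        rfl
      have hL2 : IsLoop (z :: x₀ :: x₁ :: v :: x₃ :: A) := by
        obtain ⟨n, hn⟩ := hrot2; exact hn ▸ hL.rotate n
      have hx₀ : x₁ + x₃ - v = x₀ := hv'.trans h0
      have hL2' : IsLoop (z :: x₀ :: x₃ :: A) := bwd_isLoop hL2 hx₀
      refine ⟨z :: x₀ :: x₃ :: A, hL2', ?_, ?_, ?_⟩
      · intro hQ
        apply toL
        apply QQ_of_isRotated_ST hrot2.symm (by simp)
        refine ⟨(x₁, v), ?_, ?_⟩
        · rw [cdarts_cons_cons]; simp [pdarts]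
        · rw [← cycTurn_bwd hL2 hab hx₀, QQ_all_ST hL2' hQ (mem_cdarts_window3_ST z x₀ x₃ A),
            wnd_rf_bwd_ST hL2 hL2' h13 hx₀]
      · left
        rw [← hlenL]
        have := congrArg List.length hA
        simp only [length_cons, length_append, length_nil] at this ⊢
        omega
      · intro p hp
        apply hBL
        rw [hrot2.mem_iff]
        simp only [mem_cons] at hp ⊢
        tauto
    · by_cases h4 : v + dir 0 + dir 3 = x₄
      · -- forward shortcut
        left
        have hx₄ : x₁ + x₃ - v = x₄ := hv'.trans h4
        have hL' : IsLoop (x₀ :: x₁ :: x₄ :: R) := fwd_isLoop hL hx₄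
        refine ⟨x₀ :: x₁ :: x₄ :: R, hL', ?_, ?_, ?_⟩
        · intro hQ
          apply toL
          refine ⟨(x₁, v), mem_cdarts_window_ST x₀ x₁ v x₃ x₄ R, ?_⟩
          rw [← cycTurn_fwd hL hab hx₄, QQ_all_ST hL' hQ (mem_cdarts_window3_ST x₀ x₁ x₄ R),
            wnd_rf_fwd_ST hL hL' h13 hx₄]
        · left; rw [← hlenL]; simp
        · intro p hp
          apply hBL
          simp only [mem_cons] at hp ⊢
          tauto
      · -- move on along the diagonal
        right
        exact (cornerAt_next hL h13 hmem h0 h4).of_isRotated hrot.symm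
  · -- flip
    left
    have hL' : IsLoop (x₀ :: x₁ :: (x₁ + x₃ - v) :: x₃ :: x₄ :: R) := flip_isLoop hL (hv' ▸ hmem)
    refine ⟨x₀ :: x₁ :: (x₁ + x₃ - v) :: x₃ :: x₄ :: R, hL', ?_, ?_, ?_⟩
    · intro hQ
      apply toL
      refine ⟨(x₁, v), mem_cdarts_window_ST x₀ x₁ v x₃ x₄ R, ?_⟩
      rw [← cycTurn_flip hL hab (hv' ▸ hmem), QQ_all_ST hL' hQ (mem_cdarts_window_ST x₀ x₁ (x₁ + x₃ - v) x₃ x₄ R),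
        wnd_rf_flip_ST hL hL' h13]
    · right
      refine ⟨by rw [← hlenL]; simp, ?_⟩
      rw [← hhtL]
      simp only [height_cons, hv']
      have e : (v + dir 0 + dir 3).2 = v.2 - 1 := by simp [dir]; ring
      rw [e]
      omega
    · intro p hp
      simp only [mem_cons] at hp
      rcases hp with rfl | rfl | rfl | rfl | rfl | hp
      · exact hBL _ (by simp)
      · exact hBL _ (by simp)
      · rw [hv']; simpa [dir] using hdown
      · exact hBL _ (by simp)
      · exact hBL _ (by simp)
      · exact hBL _ (by simp [hp])

/-! ## The induction -/

/-- The diagonal points are pairwise distinct (the tree's `RectLoop.diag_injective`). -/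
theorem QQ_of_isLoop_ST {l : List (ℤ × ℤ)} (hl : IsLoop l) : (∃ d ∈ cdarts l, cycTurn l = 4 + 8 * wnd l (rf d)) := by
  -- a level below the loop
  obtain ⟨B, hB⟩ : ∃ B : ℤ, ∀ p ∈ l, B ≤ p.2 := by
    refine ⟨-(l.map fun p => |p.2|).sum, fun p hp => ?_⟩
    have h1 : |p.2| ≤ (l.map fun p => |p.2|).sum :=
      List.single_le_sum (fun x hx => by obtain ⟨y, -, rfl⟩ := mem_map.1 hx; exact abs_nonneg _) _
        (mem_map.2 ⟨p, hp, rfl⟩)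
    have h2 : -|p.2| ≤ p.2 := neg_abs_le _
    linarith
  suffices key : ∀ (n : ℕ) (h : ℕ) (l : List (ℤ × ℤ)), IsLoop l → l.length = n → height B l = h →
      (∀ p ∈ l, B ≤ p.2) → (∃ d ∈ cdarts l, cycTurn l = 4 + 8 * wnd l (rf d)) from key _ _ l hl rfl rfl hB
  intro n
  induction n using Nat.strong_induction_on with
  | _ n ihn =>
  intro h
  induction h using Nat.strong_induction_on with
  | _ h ihh =>
  intro l hl hlen hh hB
  rcases Nat.lt_or_ge n 5 with hsmall | h5
  · -- small loops: four vertices, rotate the top-left vertex to the front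
    have h3 := hl.three_le
    match l, hlen, h3 with
    | [a, b, c], _, _ => exact absurd hl (not_isLoop_three a b c)
    | [x₀, y₁, y₂, y₃], _, _ =>
      obtain ⟨q, hq, htop⟩ := exists_topleft (l := [x₀, y₁, y₂, y₃]) (by simp)
      -- rotate `q` to the front
      obtain ⟨k, hk4, hk⟩ : ∃ k < 4, ([x₀, y₁, y₂, y₃].rotate k).head? = some q := by
        simp only [mem_cons, mem_nil_iff, or_false] at hq
        rcases hq with rfl | rfl | rfl | rfl
        · exact ⟨0, by omega, rfl⟩
        · exact ⟨1, by omega, rfl⟩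
        · exact ⟨2, by omega, rfl⟩
        · exact ⟨3, by omega, rfl⟩
      have hl' := hl.rotate k
      have hlen' : ([x₀, y₁, y₂, y₃].rotate k).length = 4 := by simp
      match hM : [x₀, y₁, y₂, y₃].rotate k, hlen' with
      | [q', z₁, z₂, z₃], _ =>
        rw [hM] at hk hl'
        simp only [head?_cons, Option.some.injEq] at hk
        subst hk
        have hrot : [x₀, y₁, y₂, y₃] ~r [q', z₁, z₂, z₃] := ⟨k, hM⟩
        apply QQ_of_isRotated_ST hrot.symm (by simp)
        refine ⟨(q', z₁), by rw [cdarts_four]; simp, base_four_ST hl' fun p hp => htop p (hrot.mem_iff.2 hp)⟩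
    | a :: b :: c :: d :: e :: r, hlen, _ => simp at hlen; omega
  · -- the walk along the diagonal from the top-left vertex
    obtain ⟨q, hq, htop⟩ := exists_topleft (l := l) (by rintro rfl; simp at hlen; omega)
    have hc0 : CornerAt l q := cornerAt_topleft hl (hlen ▸ h5) hq htop
    have walk : ∀ k : ℕ, (∃ l', IsLoop l' ∧ ((∃ d ∈ cdarts l', cycTurn l' = 4 + 8 * wnd l' (rf d)) → (∃ d ∈ cdarts l, cycTurn l = 4 + 8 * wnd l (rf d))) ∧
        (l'.length + 2 = l.length ∨ (l'.length = l.length ∧ height B l' < height B l)) ∧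
        ∀ p ∈ l', B ≤ p.2) ∨ ∀ j ≤ k, CornerAt l (q + (j : ℤ) • (dir 0 + dir 3)) := by
      intro k
      induction k with
      | zero => right; intro j hj; obtain rfl : j = 0 := Nat.le_zero.1 hj; simpa using hc0
      | succ k ih =>
        rcases ih with good | hall
        · exact Or.inl good
        · rcases exists_move_or_cornerAt_QQ_ST hl (hall k le_rfl) B hB with good | hnext
          · exact Or.inl good
          · right
            intro j hj
            rcases Nat.lt_or_ge j (k + 1) with hlt | hge
            · exact hall j (by omega)
            · obtain rfl : j = k + 1 := le_antisymm hj hge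
              have e : q + ((k + 1 : ℕ) : ℤ) • (dir 0 + dir 3) = q + (k : ℤ) • (dir 0 + dir 3) + dir 0 + dir 3 := by
                push_cast
                rw [add_smul, one_smul]
                abel
              rw [e]
              exact hnext
    rcases walk n with ⟨l', hl', himp, hμ, hB'⟩ | hall
    · apply himp
      rcases hμ with hlt | ⟨heq, hht⟩
      · exact ihn l'.length (by omega) (height B l') l' hl' rfl rfl hB'
      · exact ihh (height B l') (by omega) l' hl' (by omega) rfl hB'
    · -- pigeonhole: `n + 1` distinct diagonal points in a list of length `n`
      exfalso
      have hsub : ((range (n + 1)).map fun k : ℕ => q + (k : ℤ) • (dir 0 + dir 3)) <+~ l := by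
        refine subperm_of_subset ((nodup_range).map (diag_injective q)) fun x hx => ?_
        obtain ⟨k, hk, rfl⟩ := mem_map.1 hx
        exact (hall k (by simpa [Nat.lt_succ_iff] using hk)).mem
      have := hsub.length_le
      simp only [length_map, length_range] at this
      omega

/-! ## The theorems -/

/-- **Hopf's Umlaufsatz with the sign of the winding number for simple rectilinear lattice loops** (registered
helper `simpleLoop_cycTurn_eq_ST` of stmt-CriticalPhenomena-11387): the turning of a rectilinear lattice loop is
`4 + 8 ·` the winding number of the face to the right of any of its steps (`+4` and `0`: counter-clockwise,
interior on the left; `-4` and `-1`: clockwise, interior on the right). -/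
theorem simpleLoop_cycTurn_eq_ST : ∀ (l : List (ℤ × ℤ)) (d : (ℤ × ℤ) × (ℤ × ℤ)), Literature.Topology.PlaneTopology.RectLoop.IsLoop l → d ∈ MedialTrail.cdarts l → Literature.Topology.PlaneTopology.RectLoop.cycTurn l = 4 + 8 * MedialTrail.wnd l (MedialTrail.rf d) :=
  fun _ _ hl hd => QQ_all_ST hl (QQ_of_isLoop_ST hl) hd

/-- The two-sided form: `cycTurn l = 4 · (wnd l (lf d) + wnd l (rf d))` for every step `d` of the loop. -/
theorem simpleLoop_wnd_sides_ST {l : List (ℤ × ℤ)} (hl : IsLoop l) {d : Pt × Pt} (hd : d ∈ cdarts l) :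
    cycTurn l = 4 * (wnd l (lf d) + wnd l (rf d)) := by
  rw [simpleLoop_cycTurn_eq_ST l d hl hd, simpleLoop_wnd_lf_ST hl hd]; ring

end Summit.CriticalPhenomena.CardyFormulaZ2.Cruxes.EdgePrecompact.QkzStripBoundaryArm
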